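import Mathlib
import Literature.Computability.AlgebraicComplexity.BI17QuadraticPolystableProofs
import Summits.ValiantsHypothesis.ValiantsHypothesis.Theorems.GeneratorObstructionsPerGenDegreeSuperQPTwoMonomialsRay
import Summits.ValiantsHypothesis.ValiantsHypothesis.Theorems.GeneratorObstructionsPerGenDegreeSuperQPBinaryRay

/-!
# Route GeneratorObstructions — K1 `PerGenDegreeSuperQP` (stmt-ValiantsHypothesis-11654),
# line `per-side-atoms`: the rays `j = 3` and `j = 4` of `S(per_m)` are hit for EVERY `m ≥ 2`

Support file of the line (`--supports stmt-ValiantsHypothesis-11654`).  The landed occupancy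
catalogue of the rectangular rays `(k^j)^*` of the occurrence monoid `S(per_m)`
(`…BiCollapsedPermanentRays`, `…TwoMonomialsRay`, `…FermatChowRay`, `…BinaryRay`) consists of
products `r₁ r₂` and sums `r + p` of divisors of `m` (for `m` prime: `1, 2, m, m+1, 2m, m²`).  Here:
binary FERMAT factors.  In `per_m` of a matrix supported on the diagonal and the cyclic
super-diagonal only `σ = 1` and the shift survive (tree `linSubst_cycleDiag_labels_perFormLex`);
putting the linear forms `x_{00} - ζ^c x_{01}` (`ζ` a primitive `m`-th root of unity) on the diagonal
and `x_{10}` (resp. `x_{10} - ζ^c x_{11}`) on the cycle gives, by the cyclotomic factorisation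
`∏_c (x - ζ^c y) = x^m - y^m` (`prod_X_sub_C_pow_mul`), the degenerations
`x_{00}^m - x_{01}^m + x_{10}^m` and `x_{00}^m - x_{01}^m + x_{10}^m - x_{11}^m` of `per_m`
(`diagFermat₃_mem_orbitClosure_per`, `diagFermat₄_mem_orbitClosure_per`, via the pair substitution
`exists_linSubst_pair`).  Diagonal forms with nonzero coefficients are polystable
(`isPolystable_sum_C_mul_X_pow`, from BI 2017 Cor. 2.9), so by the ray criterion **the rays `j = 3`
and `j = 4` of `S(per_m)` are hit and carry an atom** (`per_ray_three_hit`, `per_ray_four_hit`,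
`per_exists_ray_atom_three`, `per_exists_ray_atom_four`); for `m` prime the known hit rays are now
`1, 2, 3, 4, m, m+1, 2m, m²`.  The first-occurrence degrees on these rays — a super-quasi-polynomial
one, infinitely often, is the registered `stub_atomLate` — remain open.  Honest framing:
unconditional structure theorems; `stub_atomLate` (`c ≥ 2`), K1 and `GenFlipThesis` remain OPEN;
nothing here bears on VP versus VNP.  References: [BurgisserIkenmeyer2017] Prop. 2.8, Cor. 2.9,
Def. 3.3; [MulmuleySohoni2001] §4.
-/

set_option linter.dupNamespace false

noncomputable section

namespace Summit.ValiantsHypothesis.ValiantsHypothesis.Theorems.GeneratorObstructions.PerGenDegreeSuperQP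

open MvPolynomial
open Literature.NumberTheory.DiophantineGeometry Literature.Computability.AlgebraicComplexity
  Literature.Computability.Complexity

/-! ### 1. Cyclotomic factorisation and diagonal forms -/

section Cyclotomic

variable {σ : Type*}
/-- **`∏_{c<m} (x - ζ^c y) = x^m - y^m`** in `MvPolynomial σ ℂ`, for `ζ` a primitive `m`-th root of
unity (`m ≥ 1`). [folklore] -/
theorem prod_X_sub_C_pow_mul {m : ℕ} (hm : 0 < m) {ζ : ℂ} (hζ : IsPrimitiveRoot ζ m)
    (x y : MvPolynomial σ ℂ) :
    ∏ c : Fin m, (x - C (ζ ^ (c : ℕ)) * y) = x ^ m - y ^ m := by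
  classical
  have hζR : IsPrimitiveRoot (C ζ : MvPolynomial σ ℂ) m := hζ.map_of_injective (C_injective σ ℂ)
  have hinj : Function.Injective fun c : Fin m => (C (ζ ^ (c : ℕ)) : MvPolynomial σ ℂ) := by
    intro a b h
    have h' : ζ ^ (a : ℕ) = ζ ^ (b : ℕ) := C_injective σ ℂ h
    exact Fin.ext (hζ.pow_inj a.is_lt b.is_lt h')
  have himage : Finset.univ.image (fun c : Fin m => (C (ζ ^ (c : ℕ)) : MvPolynomial σ ℂ)) =
      Polynomial.nthRootsFinset m (1 : MvPolynomial σ ℂ) := by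
    apply Finset.eq_of_subset_of_card_le
    · intro μ hμ
      obtain ⟨c, -, rfl⟩ := Finset.mem_image.mp hμ
      rw [Polynomial.mem_nthRootsFinset hm]
      rw [← map_pow, ← pow_mul, mul_comm, pow_mul, hζ.pow_eq_one, one_pow, map_one]
    · rw [hζR.card_nthRootsFinset, Finset.card_image_of_injective _ hinj, Finset.card_univ,
        Fintype.card_fin]
  have key : x ^ m - y ^ m = ∏ μ ∈ Polynomial.nthRootsFinset m (1 : MvPolynomial σ ℂ), (x - μ * y) :=
    IsPrimitiveRoot.pow_sub_pow_eq_prod_sub_mul x y hm hζR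
  rw [key, ← himage, Finset.prod_image fun a _ b _ h => hinj h]

/-- **Diagonal forms with nonzero coefficients are polystable**: `∑_i a_i x_i^m` on `Fin j`
(`m ≥ 2`, all `a_i ≠ 0`) — it is the image of `x₁^m + ⋯ + x_j^m` (polystable, BI 2017 Cor. 2.9, tree
`isPolystable_sum_X_pow`) under the invertible diagonal substitution `x_i ↦ a_i^{1/m} x_i`
(`IsPolystable.linSubst_of_det_ne_zero`). [cite: BurgisserIkenmeyer2017, Cor. 2.9] -/
theorem isPolystable_sum_C_mul_X_pow {j m : ℕ} (hm : 2 ≤ m) (a : Fin j → ℂ) (ha : ∀ i, a i ≠ 0) :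
    IsPolystable (∑ i : Fin j, C (a i) * X i ^ m : MvPolynomial (Fin j) ℂ) := by
  classical
  have hroot : ∀ i, ∃ z : ℂ, z ^ m = a i := fun i => IsAlgClosed.exists_pow_nat_eq (a i) (by omega)
  choose d hd using hroot
  have hd0 : ∀ i, d i ≠ 0 := by
    intro i h0
    apply ha i
    rw [← hd i, h0, zero_pow (by omega)]
  have hX : ∀ i, linSubst (Fin j) ℂ (Matrix.diagonal d) (X i) = C (d i) * X i := by
    intro i
    rw [linSubst_X, Finset.sum_eq_single i (fun b _ hb => by rw [Matrix.diagonal_apply_ne _ hb, zero_smul])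
      (fun h => absurd (Finset.mem_univ i) h), Matrix.diagonal_apply_eq, smul_eq_C_mul]
  have heq : linSubst (Fin j) ℂ (Matrix.diagonal d) (∑ i : Fin j, X i ^ m) =
      ∑ i : Fin j, C (a i) * X i ^ m := by
    rw [map_sum]
    refine Finset.sum_congr rfl fun i _ => ?_
    rw [map_pow, hX, mul_pow, ← map_pow, hd]
  rw [← heq]
  refine IsPolystable.linSubst_of_det_ne_zero (isPolystable_sum_X_pow j (D := m) (by omega)) ?_
  rw [Matrix.det_diagonal]
  exact Finset.prod_ne_zero_iff.mpr fun i _ => hd0 i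

/-- `∑_i a_i x_i^m` is a form of degree `m`. [folklore] -/
theorem sum_C_mul_X_pow_isHomogeneous {j : ℕ} (m : ℕ) (a : Fin j → ℂ) :
    (∑ i : Fin j, C (a i) * X i ^ m : MvPolynomial (Fin j) ℂ).IsHomogeneous m :=
  IsHomogeneous.sum _ _ _ fun i _ => by
    simpa using (isHomogeneous_C (Fin j) (a i)).mul ((isHomogeneous_X ℂ i).pow m)

/-- `∑_i a_i x_i^m ≠ 0` if `a_0 ≠ 0` (`j ≥ 1`, `m ≥ 1`). [folklore] -/
theorem sum_C_mul_X_pow_ne_zero {j m : ℕ} (hm : 0 < m) (a : Fin (j + 1) → ℂ) (ha : a 0 ≠ 0) :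
    (∑ i : Fin (j + 1), C (a i) * X i ^ m : MvPolynomial (Fin (j + 1)) ℂ) ≠ 0 := by
  classical
  intro h
  have hc := congrArg (coeff (Finsupp.single (0 : Fin (j + 1)) m)) h
  rw [coeff_sum, coeff_zero, Finset.sum_eq_single (0 : Fin (j + 1))] at hc
  · rw [coeff_C_mul, coeff_X_pow, if_pos rfl, mul_one] at hc
    exact ha hc
  · intro b _ hb
    rw [coeff_C_mul, coeff_X_pow, if_neg, mul_zero]
    intro hs
    exact hb (Finsupp.single_left_injective (by omega) hs)
  · intro h0; exact absurd (Finset.mem_univ _) h0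
end Cyclotomic

/-! ### 2. The pair substitution and the two degenerations of `per_m` -/

section Degeneration

variable {m : ℕ} [NeZero m]

/-- **The pair substitution.** For coefficient vectors `α β : Fin m → ℂ` there is a linear
substitution of the matrix variables with `x_{0c} ↦ x_{00} + α_c x_{01}` and
`x_{1c} ↦ x_{10} + β_c x_{11}` (`m ≥ 2`). [folklore] -/
theorem exists_linSubst_pair (hm : 2 ≤ m) (α β : Fin m → ℂ) :
    ∃ B : Matrix (MatIdx m) (MatIdx m) ℂ, ∀ c : Fin m,
      linSubst (MatIdx m) ℂ B (X (toLex ((0 : Fin m), c) : MatIdx m)) =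
          X (toLex ((0 : Fin m), (0 : Fin m)) : MatIdx m) +
            C (α c) * X (toLex ((0 : Fin m), (1 : Fin m)) : MatIdx m) ∧
      linSubst (MatIdx m) ℂ B (X (toLex ((1 : Fin m), c) : MatIdx m)) =
          X (toLex ((1 : Fin m), (0 : Fin m)) : MatIdx m) +
            C (β c) * X (toLex ((1 : Fin m), (1 : Fin m)) : MatIdx m) := by
  classical
  have h10 := fin_one_ne_zero hm
  -- `B u v`: the coefficient of the letter `u` in the image of the letter `v`
  refine ⟨Matrix.of fun u v : MatIdx m =>
      if (ofLex v).1 = 0 then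
        (if u = toLex ((0 : Fin m), (0 : Fin m)) then (1 : ℂ)
          else if u = toLex ((0 : Fin m), (1 : Fin m)) then α (ofLex v).2 else 0)
      else if (ofLex v).1 = 1 then
        (if u = toLex ((1 : Fin m), (0 : Fin m)) then (1 : ℂ)
          else if u = toLex ((1 : Fin m), (1 : Fin m)) then β (ofLex v).2 else 0)
      else 0, fun c => ⟨?_, ?_⟩⟩
  · rw [linSubst_X]
    have hne : (toLex ((0 : Fin m), (0 : Fin m)) : MatIdx m) ≠ toLex ((0 : Fin m), (1 : Fin m)) := by
      intro h; have := congrArg (fun z : MatIdx m => (ofLex z).2) h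
      simp only [ofLex_toLex] at this; exact h10 this.symm
    have hfun : ∀ u : MatIdx m, (Matrix.of fun u v : MatIdx m =>
        if (ofLex v).1 = 0 then
          (if u = toLex ((0 : Fin m), (0 : Fin m)) then (1 : ℂ)
            else if u = toLex ((0 : Fin m), (1 : Fin m)) then α (ofLex v).2 else 0)
        else if (ofLex v).1 = 1 then
          (if u = toLex ((1 : Fin m), (0 : Fin m)) then (1 : ℂ)
            else if u = toLex ((1 : Fin m), (1 : Fin m)) then β (ofLex v).2 else 0)
        else 0) u (toLex ((0 : Fin m), c)) • (X u : MvPolynomial (MatIdx m) ℂ) =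
        (if u = toLex ((0 : Fin m), (0 : Fin m)) then (X u : MvPolynomial (MatIdx m) ℂ) else 0) +
        (if u = toLex ((0 : Fin m), (1 : Fin m)) then α c • (X u : MvPolynomial (MatIdx m) ℂ) else 0) := by
      intro u
      simp only [Matrix.of_apply, ofLex_toLex, if_true]
      by_cases h0 : u = toLex ((0 : Fin m), (0 : Fin m))
      · subst h0; simp [hne]
      · by_cases h1 : u = toLex ((0 : Fin m), (1 : Fin m))
        · subst h1; simp [h0]
        · simp [h0, h1]
    simp_rw [hfun, Finset.sum_add_distrib, Finset.sum_ite_eq', Finset.mem_univ, if_true,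
      smul_eq_C_mul]
  · rw [linSubst_X]
    have hne : (toLex ((1 : Fin m), (0 : Fin m)) : MatIdx m) ≠ toLex ((1 : Fin m), (1 : Fin m)) := by
      intro h; have := congrArg (fun z : MatIdx m => (ofLex z).2) h
      simp only [ofLex_toLex] at this; exact h10 this.symm
    have hfun : ∀ u : MatIdx m, (Matrix.of fun u v : MatIdx m =>
        if (ofLex v).1 = 0 then
          (if u = toLex ((0 : Fin m), (0 : Fin m)) then (1 : ℂ)
            else if u = toLex ((0 : Fin m), (1 : Fin m)) then α (ofLex v).2 else 0)
        else if (ofLex v).1 = 1 then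
          (if u = toLex ((1 : Fin m), (0 : Fin m)) then (1 : ℂ)
            else if u = toLex ((1 : Fin m), (1 : Fin m)) then β (ofLex v).2 else 0)
        else 0) u (toLex ((1 : Fin m), c)) • (X u : MvPolynomial (MatIdx m) ℂ) =
        (if u = toLex ((1 : Fin m), (0 : Fin m)) then (X u : MvPolynomial (MatIdx m) ℂ) else 0) +
        (if u = toLex ((1 : Fin m), (1 : Fin m)) then β c • (X u : MvPolynomial (MatIdx m) ℂ) else 0) := by
      intro u
      simp only [Matrix.of_apply, ofLex_toLex, (fin_one_ne_zero hm), if_false, if_true]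
      by_cases h0 : u = toLex ((1 : Fin m), (0 : Fin m))
      · subst h0; simp [hne]
      · by_cases h1 : u = toLex ((1 : Fin m), (1 : Fin m))
        · subst h1; simp [h0]
        · simp [h0, h1]
    simp_rw [hfun, Finset.sum_add_distrib, Finset.sum_ite_eq', Finset.mem_univ, if_true,
      smul_eq_C_mul]

/-- **Two-step degeneration of `per_m`**: for `α β : Fin m → ℂ` the form
`∏_c (x_{00} + α_c x_{01}) + ∏_c (x_{10} + β_c x_{11})` lies in `End·per_m ⊆ Δ(per_m)` — first the
label substitution `x_{cc} ↦ x_{0c}`, `x_{r,r+1} ↦ x_{1c}` (only `σ = 1` and the shift survive: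
`∏ x_{0c} + ∏ x_{1c}`), then the pair substitution. [cite: MulmuleySohoni2001, §4] -/
theorem pairProduct_mem_orbitClosure_per (hm : 2 ≤ m) (α β : Fin m → ℂ) :
    (∏ c : Fin m, (X (toLex ((0 : Fin m), (0 : Fin m)) : MatIdx m) +
        C (α c) * X (toLex ((0 : Fin m), (1 : Fin m)) : MatIdx m)) +
      ∏ c : Fin m, (X (toLex ((1 : Fin m), (0 : Fin m)) : MatIdx m) +
        C (β c) * X (toLex ((1 : Fin m), (1 : Fin m)) : MatIdx m)) : MvPolynomial (MatIdx m) ℂ) ∈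
      orbitClosure (MvPolynomial.rename (toLex : Fin m × Fin m → MatIdx m) (perPoly (Fin m) ℂ)) := by
  haveI : Infinite ℂ := CharZero.infinite ℂ
  obtain ⟨A, hA⟩ := exists_linSubst_cycleDiag_labels hm
    (fun c => (toLex ((0 : Fin m), c) : MatIdx m)) (fun c => (toLex ((1 : Fin m), c) : MatIdx m))
  have hg := linSubst_cycleDiag_labels_perFormLex hm _ _ hA
  obtain ⟨B, hB⟩ := exists_linSubst_pair hm α β
  have hh : linSubst (MatIdx m) ℂ (B * A)
        (MvPolynomial.rename (toLex : Fin m × Fin m → MatIdx m) (perPoly (Fin m) ℂ)) =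
      (∏ c : Fin m, (X (toLex ((0 : Fin m), (0 : Fin m)) : MatIdx m) +
          C (α c) * X (toLex ((0 : Fin m), (1 : Fin m)) : MatIdx m)) +
        ∏ c : Fin m, (X (toLex ((1 : Fin m), (0 : Fin m)) : MatIdx m) +
          C (β c) * X (toLex ((1 : Fin m), (1 : Fin m)) : MatIdx m))) := by
    rw [linSubst_mul, AlgHom.comp_apply, hg, map_add, map_prod, map_prod]
    simp only [(hB _).1, (hB _).2]
  rw [← hh]
  exact endOrbit_subset_orbitClosure_holds (k := ℂ) (σ := MatIdx m) _ ⟨B * A, rfl⟩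

/-- **`x_{00}^m - x_{01}^m + x_{10}^m ∈ Δ(per_m)`** (`m ≥ 2`): take `α_c = -ζ^c` (cyclotomic
factorisation on the diagonal) and `β = 0`. [cite: MulmuleySohoni2001, §4] -/
theorem diagFermat₃_mem_orbitClosure_per (hm : 2 ≤ m) :
    (X (toLex ((0 : Fin m), (0 : Fin m)) : MatIdx m) ^ m -
        X (toLex ((0 : Fin m), (1 : Fin m)) : MatIdx m) ^ m +
        X (toLex ((1 : Fin m), (0 : Fin m)) : MatIdx m) ^ m : MvPolynomial (MatIdx m) ℂ) ∈
      orbitClosure (MvPolynomial.rename (toLex : Fin m × Fin m → MatIdx m) (perPoly (Fin m) ℂ)) := by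
  have hm0 : 0 < m := by omega
  have hζ := Complex.isPrimitiveRoot_exp m (by omega)
  set ζ : ℂ := Complex.exp (2 * Real.pi * Complex.I / m) with hζdef
  have h := pairProduct_mem_orbitClosure_per hm (fun c => -(ζ ^ (c : ℕ))) (fun _ => 0)
  have hprod₁ : ∏ c : Fin m, (X (toLex ((0 : Fin m), (0 : Fin m)) : MatIdx m) +
      C (-(ζ ^ (c : ℕ))) * X (toLex ((0 : Fin m), (1 : Fin m)) : MatIdx m) : MvPolynomial (MatIdx m) ℂ) =
      X (toLex ((0 : Fin m), (0 : Fin m))) ^ m - X (toLex ((0 : Fin m), (1 : Fin m))) ^ m := by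
    rw [← prod_X_sub_C_pow_mul hm0 hζ]
    refine Finset.prod_congr rfl fun c _ => ?_
    rw [map_neg, neg_mul, sub_eq_add_neg]
  have hprod₂ : ∏ _c : Fin m, (X (toLex ((1 : Fin m), (0 : Fin m)) : MatIdx m) +
      C (0 : ℂ) * X (toLex ((1 : Fin m), (1 : Fin m)) : MatIdx m) : MvPolynomial (MatIdx m) ℂ) =
      X (toLex ((1 : Fin m), (0 : Fin m))) ^ m := by
    rw [map_zero]
    simp
  rw [hprod₁, hprod₂] at h
  exact h

/-- **`x_{00}^m - x_{01}^m + x_{10}^m - x_{11}^m ∈ Δ(per_m)`** (`m ≥ 2`): `α_c = β_c = -ζ^c`.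
[cite: MulmuleySohoni2001, §4] -/
theorem diagFermat₄_mem_orbitClosure_per (hm : 2 ≤ m) :
    (X (toLex ((0 : Fin m), (0 : Fin m)) : MatIdx m) ^ m -
        X (toLex ((0 : Fin m), (1 : Fin m)) : MatIdx m) ^ m +
        (X (toLex ((1 : Fin m), (0 : Fin m)) : MatIdx m) ^ m -
          X (toLex ((1 : Fin m), (1 : Fin m)) : MatIdx m) ^ m) : MvPolynomial (MatIdx m) ℂ) ∈
      orbitClosure (MvPolynomial.rename (toLex : Fin m × Fin m → MatIdx m) (perPoly (Fin m) ℂ)) := by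
  have hm0 : 0 < m := by omega
  have hζ := Complex.isPrimitiveRoot_exp m (by omega)
  set ζ : ℂ := Complex.exp (2 * Real.pi * Complex.I / m) with hζdef
  have h := pairProduct_mem_orbitClosure_per hm (fun c => -(ζ ^ (c : ℕ))) (fun c => -(ζ ^ (c : ℕ)))
  have hprod : ∀ a b : MatIdx m, ∏ c : Fin m, ((X a : MvPolynomial (MatIdx m) ℂ) +
      C (-(ζ ^ (c : ℕ))) * X b) = X a ^ m - X b ^ m := by
    intro a b
    rw [← prod_X_sub_C_pow_mul hm0 hζ]
    refine Finset.prod_congr rfl fun c _ => ?_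
    rw [map_neg, neg_mul, sub_eq_add_neg]
  rw [hprod, hprod] at h
  exact h
end Degeneration

/-! ### 3. The rays `j = 3` and `j = 4` -/

section Rays

variable {m : ℕ}

/-- The three letters are distinct (`m ≥ 2`). -/
private theorem κ₃_injective [NeZero m] (hm : 2 ≤ m) : Function.Injective (![toLex ((0 : Fin m), (0 : Fin m)), toLex ((0 : Fin m), (1 : Fin m)), toLex ((1 : Fin m), (0 : Fin m))] : Fin 3 → MatIdx m) := by
  have h10 := fin_one_ne_zero hm
  have h01 : (0 : Fin m) ≠ 1 := fun h => h10 h.symm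
  rw [← List.nodup_ofFn]
  simp [h10, h01]

/-- The four letters are distinct (`m ≥ 2`). -/
private theorem κ₄_injective [NeZero m] (hm : 2 ≤ m) : Function.Injective (![toLex ((0 : Fin m), (0 : Fin m)), toLex ((0 : Fin m), (1 : Fin m)), toLex ((1 : Fin m), (0 : Fin m)), toLex ((1 : Fin m), (1 : Fin m))] : Fin 4 → MatIdx m) := by
  have h10 := fin_one_ne_zero hm
  have h01 : (0 : Fin m) ≠ 1 := fun h => h10 h.symm
  rw [← List.nodup_ofFn]
  simp [h10, h01]

/-- The ternary diagonal form `x₀^m - x₁^m + x₂^m` placed at `x_{00}, x_{01}, x_{10}`. -/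
private theorem rename_κ₃_eq [NeZero m] :
    MvPolynomial.rename (![toLex ((0 : Fin m), (0 : Fin m)), toLex ((0 : Fin m), (1 : Fin m)), toLex ((1 : Fin m), (0 : Fin m))] : Fin 3 → MatIdx m) (∑ i : Fin 3, C (![(1 : ℂ), -1, 1] i) * X i ^ m) =
      (X (toLex ((0 : Fin m), (0 : Fin m)) : MatIdx m) ^ m -
        X (toLex ((0 : Fin m), (1 : Fin m)) : MatIdx m) ^ m +
        X (toLex ((1 : Fin m), (0 : Fin m)) : MatIdx m) ^ m : MvPolynomial (MatIdx m) ℂ) := by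
  rw [Fin.sum_univ_three]
  simp only [map_add, map_mul, rename_C, map_pow, rename_X]
  simp
  ring

/-- The quaternary diagonal form `x₀^m - x₁^m + x₂^m - x₃^m` placed at `x_{00}, x_{01}, x_{10}, x_{11}`. -/
private theorem rename_κ₄_eq [NeZero m] :
    MvPolynomial.rename (![toLex ((0 : Fin m), (0 : Fin m)), toLex ((0 : Fin m), (1 : Fin m)), toLex ((1 : Fin m), (0 : Fin m)), toLex ((1 : Fin m), (1 : Fin m))] : Fin 4 → MatIdx m) (∑ i : Fin 4, C (![(1 : ℂ), -1, 1, -1] i) * X i ^ m) =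
      (X (toLex ((0 : Fin m), (0 : Fin m)) : MatIdx m) ^ m -
        X (toLex ((0 : Fin m), (1 : Fin m)) : MatIdx m) ^ m +
        (X (toLex ((1 : Fin m), (0 : Fin m)) : MatIdx m) ^ m -
          X (toLex ((1 : Fin m), (1 : Fin m)) : MatIdx m) ^ m) : MvPolynomial (MatIdx m) ℂ) := by
  rw [Fin.sum_univ_four]
  simp only [map_add, map_mul, rename_C, map_pow, rename_X]
  simp
  ring

/-- **The ray `j = 3` of `S(per_m)` is hit** (`m ≥ 2`): `(k³)^*` occurs in `ℂ[Δ_m[per_m]]` for some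
`k ≥ 1`, via the polystable ternary degeneration `x_{00}^m - x_{01}^m + x_{10}^m`.
[cite: BurgisserIkenmeyer2017, Prop. 2.8 and Def. 3.3] -/
theorem per_ray_three_hit (hm : 2 ≤ m) :
    ∃ k : ℕ, 0 < k ∧
      highestWeightSpace (orbitCoordRep (MvPolynomial.rename toLex (perPoly (Fin m) ℂ)) m)
        (partitionWeightLex m (Nat.Partition.rectangle 3 k)) ≠ ⊥ := by
  haveI : NeZero m := ⟨by omega⟩
  set a : Fin 3 → ℂ := ![(1 : ℂ), -1, 1] with ha
  have ha0 : ∀ i, a i ≠ 0 := by intro i; fin_cases i <;> simp [ha]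
  have hq : (∑ i : Fin 3, C (a i) * X i ^ m : MvPolynomial (Fin 3) ℂ).IsHomogeneous m :=
    sum_C_mul_X_pow_isHomogeneous m a
  have hq0 : (∑ i : Fin 3, C (a i) * X i ^ m : MvPolynomial (Fin 3) ℂ) ≠ 0 :=
    sum_C_mul_X_pow_ne_zero (by omega) a (by simp [ha])
  have hmem : MvPolynomial.rename (![toLex ((0 : Fin m), (0 : Fin m)), toLex ((0 : Fin m), (1 : Fin m)), toLex ((1 : Fin m), (0 : Fin m))] : Fin 3 → MatIdx m) (∑ i : Fin 3, C (a i) * X i ^ m) ∈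
      orbitClosure (MvPolynomial.rename (toLex : Fin m × Fin m → MatIdx m) (perPoly (Fin m) ℂ)) := by
    rw [ha, rename_κ₃_eq]
    exact diagFermat₃_mem_orbitClosure_per hm
  obtain ⟨k, hk, hocc⟩ := exists_hasHighestWeight_rectangle_of_isSLSemistable_projection
    (matIdxEquiv m) (show m ≠ 0 by omega) (perFormLex_isHomogeneous m) (show 0 < 3 by omega) _
    (κ₃_injective hm) hq hmem ((isPolystable_sum_C_mul_X_pow hm a ha0).isSLSemistable hq0)
  exact ⟨k, hk, hocc⟩

/-- **The ray `j = 4` of `S(per_m)` is hit** (`m ≥ 2`), via the polystable quaternary degeneration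
`x_{00}^m - x_{01}^m + x_{10}^m - x_{11}^m`. [cite: BurgisserIkenmeyer2017, Prop. 2.8 and Def. 3.3] -/
theorem per_ray_four_hit (hm : 2 ≤ m) :
    ∃ k : ℕ, 0 < k ∧
      highestWeightSpace (orbitCoordRep (MvPolynomial.rename toLex (perPoly (Fin m) ℂ)) m)
        (partitionWeightLex m (Nat.Partition.rectangle 4 k)) ≠ ⊥ := by
  haveI : NeZero m := ⟨by omega⟩
  set a : Fin 4 → ℂ := ![(1 : ℂ), -1, 1, -1] with ha
  have ha0 : ∀ i, a i ≠ 0 := by intro i; fin_cases i <;> simp [ha]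
  have hq : (∑ i : Fin 4, C (a i) * X i ^ m : MvPolynomial (Fin 4) ℂ).IsHomogeneous m :=
    sum_C_mul_X_pow_isHomogeneous m a
  have hq0 : (∑ i : Fin 4, C (a i) * X i ^ m : MvPolynomial (Fin 4) ℂ) ≠ 0 :=
    sum_C_mul_X_pow_ne_zero (by omega) a (by simp [ha])
  have hmem : MvPolynomial.rename (![toLex ((0 : Fin m), (0 : Fin m)), toLex ((0 : Fin m), (1 : Fin m)), toLex ((1 : Fin m), (0 : Fin m)), toLex ((1 : Fin m), (1 : Fin m))] : Fin 4 → MatIdx m) (∑ i : Fin 4, C (a i) * X i ^ m) ∈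
      orbitClosure (MvPolynomial.rename (toLex : Fin m × Fin m → MatIdx m) (perPoly (Fin m) ℂ)) := by
    rw [ha, rename_κ₄_eq]
    exact diagFermat₄_mem_orbitClosure_per hm
  obtain ⟨k, hk, hocc⟩ := exists_hasHighestWeight_rectangle_of_isSLSemistable_projection
    (matIdxEquiv m) (show m ≠ 0 by omega) (perFormLex_isHomogeneous m) (show 0 < 4 by omega) _
    (κ₄_injective hm) hq hmem ((isPolystable_sum_C_mul_X_pow hm a ha0).isSLSemistable hq0)
  exact ⟨k, hk, hocc⟩

/-- **The ray `j = 3` carries an atom** (`m ≥ 2`). [cite: BurgisserIkenmeyer2017, Prop. 2.8 and Def. 3.3] -/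
theorem per_exists_ray_atom_three (hm : 2 ≤ m) :
    ∃ k₀ : ℕ, 0 < k₀ ∧
      highestWeightSpace (orbitCoordRep (MvPolynomial.rename toLex (perPoly (Fin m) ℂ)) m)
        (partitionWeightLex m (Nat.Partition.rectangle 3 k₀)) ≠ ⊥ ∧
      (∀ k : ℕ, 0 < k → k < k₀ →
        highestWeightSpace (orbitCoordRep (MvPolynomial.rename toLex (perPoly (Fin m) ℂ)) m)
          (partitionWeightLex m (Nat.Partition.rectangle 3 k)) = ⊥) ∧
      (∀ χ₁ χ₂ : Weight (MatIdx m), χ₁ + χ₂ = partitionWeightLex m (Nat.Partition.rectangle 3 k₀) →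
        χ₁ ≠ 0 → χ₂ ≠ 0 →
        highestWeightSpace (orbitCoordRep (MvPolynomial.rename toLex (perPoly (Fin m) ℂ)) m) χ₁ = ⊥ ∨
          highestWeightSpace (orbitCoordRep (MvPolynomial.rename toLex (perPoly (Fin m) ℂ)) m) χ₂ = ⊥) :=
  exists_least_rectangle_atom _ _ (by omega) (by nlinarith) (per_ray_three_hit hm)

/-- **The ray `j = 4` carries an atom** (`m ≥ 2`). [cite: BurgisserIkenmeyer2017, Prop. 2.8 and Def. 3.3] -/
theorem per_exists_ray_atom_four (hm : 2 ≤ m) :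
    ∃ k₀ : ℕ, 0 < k₀ ∧
      highestWeightSpace (orbitCoordRep (MvPolynomial.rename toLex (perPoly (Fin m) ℂ)) m)
        (partitionWeightLex m (Nat.Partition.rectangle 4 k₀)) ≠ ⊥ ∧
      (∀ k : ℕ, 0 < k → k < k₀ →
        highestWeightSpace (orbitCoordRep (MvPolynomial.rename toLex (perPoly (Fin m) ℂ)) m)
          (partitionWeightLex m (Nat.Partition.rectangle 4 k)) = ⊥) ∧
      (∀ χ₁ χ₂ : Weight (MatIdx m), χ₁ + χ₂ = partitionWeightLex m (Nat.Partition.rectangle 4 k₀) →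
        χ₁ ≠ 0 → χ₂ ≠ 0 →
        highestWeightSpace (orbitCoordRep (MvPolynomial.rename toLex (perPoly (Fin m) ℂ)) m) χ₁ = ⊥ ∨
          highestWeightSpace (orbitCoordRep (MvPolynomial.rename toLex (perPoly (Fin m) ℂ)) m) χ₂ = ⊥) :=
  exists_least_rectangle_atom _ _ (by omega) (by nlinarith) (per_ray_four_hit hm)
end Rays

end Summit.ValiantsHypothesis.ValiantsHypothesis.Theorems.GeneratorObstructions.PerGenDegreeSuperQP

end
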